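import Mathlib
import HarnessLib
import Summits.SmoothPoincare4.SmoothPoincare4.Theses.RootDecompC
import Summits.SmoothPoincare4.SmoothPoincare4.Theses.ThreeFibres

/-!
# LINE «TwinSeparation» for crux MCS = `RootDecompC.StableMirrorCancellation` (stmt-SmoothPoincare4-28014, route C, species R)
decomp-sp4 lens-3 gen 11 (OffFibreSpheres v11).  MECHANISM LINE (separate, then cancel): MCS ⟸ #13903 ∧ TS ∧ SAT' — every fibre-class sphere with simply connected complement is Diff-separable from a fibre (TS, a statement about spheres in S²×S² only), and knot-and-killer surgeries are standard (SAT'). No residual stub; TS ⟹ RES' by vacuity.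
Stubs are registered `theorem stub_* : <sig> := by sorry`; the composition `StableMirrorCancellation_of (hD : ThreeFibres.SurgeryDictionary)` is
sorry-free of its own and concludes the crux BY NAME from the registered foreign item #13903 (critic 854 W1) — sorries reachable only through the two stubs.
`stub_dictionary` is the open support item #13903 `ThreeFibres.SurgeryDictionary` BY NAME (count once; known surgery
theory, GompfStipsicz1999 §5.2) — a genuine L-size formalisation lemma of the line, not a restatement of the crux.
-/

open scoped Manifold ContDiff

set_option linter.dupNamespace false

namespace Summit.SmoothPoincare4.SmoothPoincare4.Cruxes.StableMirrorCancellation.TwinSeparation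

open Summit.SmoothPoincare4.SmoothPoincare4.Theses

/-- stub 2 · TS TWIN SEPARATION (text v11/sig/sig_TwinSeparation.txt): for every framed fibre-class sphere `ν` of
`S²×S²` with `C^∞`-embedded core and simply connected complement, some diffeomorphism `ψ` of `S²×S²` carries the core off
a fibre `{x'} × S²` (equivalently: every one-stably-standard homotopy 4-sphere is of knot-and-killer type). A statement
about sphere embeddings in a standard manifold; implied by SPC4 on paper (Gluck + circle-surgery uniqueness), TOP version
true (Freedman). [size XL · open · species E-flavoured structure stub · LBT / Schneiderman–Teichner technology] -/
theorem stub_twinSeparation : open scoped ContDiff in ∀ ν : Literature.Topology.FourManifolds.FramedSphereFamily ((𝓡 2).prod (𝓡 2)) ((Metric.sphere (0 : EuclideanSpace ℝ (Fin 3)) 1) × (Metric.sphere (0 : EuclideanSpace ℝ (Fin 3)) 1)) (Fin 1) 2 2, Manifold.IsSmoothEmbedding (𝓡 2) ((𝓡 2).prod (𝓡 2)) ∞ (ν.sphere 0) → (∃ (x : Metric.sphere (0 : EuclideanSpace ℝ (Fin 3)) 1) (F G : C(Metric.sphere (0 : EuclideanSpace ℝ (Fin 3)) 1, (Metric.sphere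 (0 : EuclideanSpace ℝ (Fin 3)) 1) × (Metric.sphere (0 : EuclideanSpace ℝ (Fin 3)) 1))), ⇑F = ν.sphere 0 ∧ ⇑G = (fun p => (x, p)) ∧ F.Homotopic G) → SimplyConnectedSpace ↥(Set.range (ν.sphere 0))ᶜ → (∃ (ψ : ((Metric.sphere (0 : EuclideanSpace ℝ (Fin 3)) 1) × (Metric.sphere (0 : EuclideanSpace ℝ (Fin 3)) 1)) ≃ₘ⟮(𝓡 2).prod (𝓡 2), (𝓡 2).prod (𝓡 2)⟯ ((Metric.sphere (0 : EuclideanSpace ℝ (Fin 3)) 1) × (Metric.sphere (0 : EuclideanSpace ℝ (Fin 3)) 1))) (x' : Metric.sphere (0 : EuclideanSpace ℝ (Fin 3)) 1), ∀ p, (ψ (ν.sphere 0 p)).1 ≠ x') := by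
  sorry

/-- stub 3 · SAT' OFF-FIBRE CANCELLATION (shared with line OffFibreCells). [size XL · open · instrument T-KILLER] -/
theorem stub_offFibre : open scoped ContDiff in ∀ (M : Type) [TopologicalSpace M] [T2Space M] [SecondCountableTopology M] [ChartedSpace (EuclideanSpace ℝ (Fin 4)) M] [IsManifold (𝓡 4) ∞ M], ContinuousMap.HomotopyEquiv M (Metric.sphere (0 : EuclideanSpace ℝ (Fin 5)) 1) → ∀ ν : Literature.Topology.FourManifolds.FramedSphereFamily ((𝓡 2).prod (𝓡 2)) ((Metric.sphere (0 : EuclideanSpace ℝ (Fin 3)) 1) × (Metric.sphere (0 : EuclideanSpace ℝ (Fin 3)) 1)) (Fin 1) 2 2, Manifold.IsSmoothEmbedding (𝓡 2) ((𝓡 2).prod (𝓡 2)) ∞ (ν.sphere 0) → (∃ (x : Metric.sphere (0 : EuclideanSpace ℝ (Fin 3)) 1) (F G : C(Metric.sphere (0 : EuclideanSpace ℝ (Fin 3)) 1, (Metric.sphere (0 : EuclideanSpace ℝ (Fin 3)) 1) × (Metric.sphere (0 : EuclideanSpace ℝ (Fin 3)) 1))), ⇑F = ν.sphere 0 ∧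 ⇑G = (fun p => (x, p)) ∧ F.Homotopic G) → SimplyConnectedSpace ↥(Set.range (ν.sphere 0))ᶜ → ν.IsSurgery (𝓡 4) M → (∃ (ψ : ((Metric.sphere (0 : EuclideanSpace ℝ (Fin 3)) 1) × (Metric.sphere (0 : EuclideanSpace ℝ (Fin 3)) 1)) ≃ₘ⟮(𝓡 2).prod (𝓡 2), (𝓡 2).prod (𝓡 2)⟯ ((Metric.sphere (0 : EuclideanSpace ℝ (Fin 3)) 1) × (Metric.sphere (0 : EuclideanSpace ℝ (Fin 3)) 1))) (x' : Metric.sphere (0 : EuclideanSpace ℝ (Fin 3)) 1), ∀ p, (ψ (ν.sphere 0 p)).1 ≠ x') → Nonempty (M ≃ₘ⟮𝓡 4, 𝓡 4⟯ Metric.sphere (0 : EuclideanSpace ℝ (Fin 5)) 1) := by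
  sorry

/-- COMPOSITION (critic 854 W1 form: the FOREIGN registered item #13903 `ThreeFibres.SurgeryDictionary` is carried as a BY-NAME BINDER, not as a
sorried stub; real proof, no sorry of its own): separate (TS stub), cancel (SAT' stub) — the ROUTE crux `RootDecompC.StableMirrorCancellation`
(stmt-SmoothPoincare4-28014) from #13903; sorries reachable only through the two registered stubs. -/
theorem StableMirrorCancellation_of (hD : ThreeFibres.SurgeryDictionary) : RootDecompC.StableMirrorCancellation := by
  intro S _ hstab
  obtain ⟨e⟩ := S.nonempty_homotopyEquiv
  obtain ⟨ν, hemb, hcls, hsc, hsurg⟩ := hD S.carrier e hstab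
  exact stub_offFibre S.carrier e ν hemb hcls hsc hsurg (stub_twinSeparation ν hemb hcls hsc)

end Summit.SmoothPoincare4.SmoothPoincare4.Cruxes.StableMirrorCancellation.TwinSeparation
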